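import Literature.Computability.Complexity.HypercontractivityP2
import HarnessLib

/-!
# `(2, q)`-hypercontractivity on the uniform cube for real `q ≥ 2`, and symmetric moment bounds

Infrastructure (R. O'Donnell, *Analysis of Boolean Functions*, CUP 2014, Ch. 9, "Hypercontractivity
Theorem": `‖T_ρ f‖_q ≤ ‖f‖_p` for `ρ ≤ √((p-1)/(q-1))`; here the case `p = 2`) in the conventions of
`BooleanFourier.lean` / `HypercontractivityP2.lean` (real functions `g : (Fin m → Bool) → ℝ`,
coefficients `cubeFourierCoeff g S = ĝ(S)`, characters `walsh`, signs `sgn`, uniform averages written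
`(∑ x, …) / 2 ^ m`). First consumer: the Keller–Lifshitz–Marcus sharp hypercontractive inequality for
global functions on product spaces (`Literature/Combinatorics/Additive/ProductSpaceHypercontractivity`),
where the Gaussian encodings of arXiv:2307.01356 §3 are replaced by Rademacher encodings, so that the
hypercontractive input needed is exactly the uniform-cube statement of this file.

* `noiseOperator ρ g` — **the noise operator** `T_ρ g (y) = E_x[g(x) ∏ᵢ (1 + ρ χᵢ(x) χᵢ(y))]`
  (O'Donnell 2014, Def. 2.46 / Prop. 2.47: `T_ρ f = ∑_S ρ^{|S|} f̂(S) χ_S`), its Fourier expansion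
  `noiseOperator_eq_sum_walsh`, coefficient damping `cubeFourierCoeff_noiseOperator`,
  self-adjointness `sum_mul_noiseOperator_comm`, Parseval `avg_sq_noiseOperator`, the semigroup law
  `noiseOperator_noiseOperator`;
* `avg_sq_noiseOperator_le` — the tree's `(p,2)`-hypercontractivity (`stability_le_norm_rpow`,
  O'Donnell §9.4) in operator form: `E[(T_ρ g)²] ≤ (E|g|^{1+ρ²})^{2/(1+ρ²)}`;
* `noiseOperator_hypercontractive_two_q` — **`(2,q)`-hypercontractivity for real `q ≥ 2`**:
  `(E|T_ρ g|^q)^{1/q} ≤ (E[g²])^{1/2}` whenever `0 ≤ ρ` and `ρ² ≤ 1/(q-1)`; proof by duality from the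
  `(p,2)` statement (O'Donnell 2014, Ch. 9, proof of the Hypercontractivity Theorem from the
  two-function version: Hölder with `h = T_ρ g · |T_ρ g|^{q-2}`, self-adjointness, Cauchy–Schwarz,
  `(1+ρ², 2)`-hypercontractivity and monotonicity of `L^p` norms, `1 + ρ² ≤ q' = q/(q-1)`);
  `noiseOperatorOn`/`noiseOperatorOn_hypercontractive_two_q` transport it to a cube indexed by an
  arbitrary finite type;
* `avg_rpow_le_avg_rpow_of_nonneg` / `avg_rpow_mono` — monotonicity of `p`-means on a finite uniform
  space (power-mean inequality); `avg_sq_noiseOperator_le_avg_sq` (`L²`-contraction),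
  `avg_mul_le_rpow_half_mul` (Cauchy–Schwarz in `rpow` form);
* **symmetric moment bounds** (the only properties of the Gaussian used in arXiv:2307.01356, Lemma 3.2:
  "as `Z` is symmetric, all of its odd moments vanish … `‖1 + dZ‖_q^q ≥ … ≥ 1 + q²d²/9`"): for an odd
  function `W` on a cube (`W(¬e) = -W(e)`), `sum_pow_eq_zero_of_odd`, `one_add_mul_avg_sq_le_avg_pow`
  (`1 + C(n,2) E[W²] ≤ E[(1+W)^n]`) and `one_add_mul_avg_sq_le_avg_abs_rpow`
  (`1 + (q²/9) E[W²] ≤ E|1+W|^q` for real `q ≥ 2`).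

Everything is a finite sum and is proved; no named facts, no instances, no notation. The bit-flip
operator `Literature.Barriers.QuantumAdvantage.noiseOp η` of `UncorrectedNoiseFourier.lean` is
`noiseOperator (1 - 2η)` (same Fourier damping, `cubeFourierCoeff_noiseOp`); it is not imported here to
keep `Literature/Computability/Complexity` below `Literature/Barriers`.

## References

* R. O'Donnell, *Analysis of Boolean Functions*, Cambridge University Press, 2014, §2.4 (noise operator,
  Prop. 2.47), Ch. 9 ("Hypercontractivity Theorem", two-function form and Hölder duality, §9.4)
  [ODonnell2014].
* A. Bonami, Ann. Inst. Fourier 20 (1970) 335–402; L. Gross, Amer. J. Math. 97 (1975) 1061–1083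
  (original sources of the `(2,q)` inequality on the cube).
* N. Keller, N. Lifshitz, O. Marcus, *Sharp hypercontractivity for global functions*, arXiv:2307.01356,
  Lemma 3.2 (the symmetric-moment step) [KellerLifshitzMarcus2023].
-/

noncomputable section

namespace Literature.Computability.Complexity.LowDegree

open Finset Real Literature.Probability.RandomGraphs.LowDegree

variable {m : ℕ}

/-! ### The noise operator -/

/-- **The noise operator** `T_ρ` on real functions on the uniform cube `{0,1}^m`:
`T_ρ g (y) = E_x[g(x) ∏ᵢ (1 + ρ χᵢ(x) χᵢ(y))]` — for `ρ ∈ [0,1]`, the expectation of `g` at a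
`ρ`-correlated copy of `y`. [cite: ODonnell2014, Def. 2.46 / Prop. 2.47] -/
def noiseOperator (ρ : ℝ) (g : (Fin m → Bool) → ℝ) (y : Fin m → Bool) : ℝ :=
  (∑ x, g x * ∏ i, (1 + ρ * sgn (x i) * sgn (y i))) / 2 ^ m

/-- **Fourier expansion of the noise operator**: `T_ρ g = ∑_S ρ^{|S|} ĝ(S) χ_S`.
[cite: ODonnell2014, Prop. 2.47] -/
theorem noiseOperator_eq_sum_walsh (ρ : ℝ) (g : (Fin m → Bool) → ℝ) (y : Fin m → Bool) :
    noiseOperator ρ g y = ∑ S : Finset (Fin m), ρ ^ S.card * cubeFourierCoeff g S * walsh S y := by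
  unfold noiseOperator cubeFourierCoeff
  simp_rw [noiseKernel_eq_sum, Finset.mul_sum, Finset.sum_div]
  rw [Finset.sum_comm]
  refine Finset.sum_congr rfl fun S _ => ?_
  rw [Finset.mul_sum, Finset.sum_mul]
  refine Finset.sum_congr rfl fun x _ => ?_
  ring

/-- **Noise damps the coefficients**: `(T_ρ g)^(S) = ρ^{|S|} ĝ(S)`. [cite: ODonnell2014, Prop. 2.47] -/
theorem cubeFourierCoeff_noiseOperator (ρ : ℝ) (g : (Fin m → Bool) → ℝ) (S : Finset (Fin m)) :
    cubeFourierCoeff (noiseOperator ρ g) S = ρ ^ S.card * cubeFourierCoeff g S := by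
  have h2 : (2 : ℝ) ^ m ≠ 0 := by positivity
  rw [cubeFourierCoeff]
  simp_rw [noiseOperator_eq_sum_walsh, Finset.sum_mul]
  rw [Finset.sum_comm]
  have e1 : ∀ T : Finset (Fin m),
      ∑ y : Fin m → Bool, ρ ^ T.card * cubeFourierCoeff g T * walsh T y * walsh S y =
        ρ ^ T.card * cubeFourierCoeff g T * (if T = S then (2 : ℝ) ^ m else 0) := by
    intro T
    rw [← sum_walsh_mul_walsh_index T S, Finset.mul_sum]
    refine Finset.sum_congr rfl fun y _ => ?_
    ring
  simp_rw [e1, mul_ite, mul_zero]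
  rw [Finset.sum_ite_eq' univ S]
  simp only [mem_univ, if_true]
  field_simp

/-- The noise operator tested against a function is the correlated double average:
`∑_y h(y) T_ρ g(y) = (∑_x ∑_y g(x) h(y) ∏ᵢ(1 + ρ χᵢ(x)χᵢ(y))) / 2^m`. [cite: ODonnell2014, §2.4] -/
theorem sum_mul_noiseOperator (ρ : ℝ) (g h : (Fin m → Bool) → ℝ) :
    ∑ y, h y * noiseOperator ρ g y =
      (∑ x, ∑ y, g x * h y * ∏ i, (1 + ρ * sgn (x i) * sgn (y i))) / 2 ^ m := by
  unfold noiseOperator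
  rw [Finset.sum_comm, Finset.sum_div]
  refine Finset.sum_congr rfl fun y _ => ?_
  rw [mul_div_assoc', Finset.mul_sum]
  congr 1
  refine Finset.sum_congr rfl fun x _ => ?_
  ring

/-- **Self-adjointness** of `T_ρ` (the kernel is symmetric): `∑_y h(y) T_ρ g(y) = ∑_x g(x) T_ρ h(x)`.
[cite: ODonnell2014, §2.4] -/
theorem sum_mul_noiseOperator_comm (ρ : ℝ) (g h : (Fin m → Bool) → ℝ) :
    ∑ y, h y * noiseOperator ρ g y = ∑ x, g x * noiseOperator ρ h x := by
  rw [sum_mul_noiseOperator, sum_mul_noiseOperator, Finset.sum_comm]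
  congr 1
  refine Finset.sum_congr rfl fun x _ => Finset.sum_congr rfl fun y _ => ?_
  congr 1
  · ring
  · exact Finset.prod_congr rfl fun i _ => by ring

/-- **Parseval for the noise operator**: `E[(T_ρ g)²] = ∑_S ρ^{2|S|} ĝ(S)²`.
[cite: ODonnell2014, §2.4 (`Stab_ρ[f] = ∑_S ρ^{|S|} f̂(S)²`)] -/
theorem avg_sq_noiseOperator (ρ : ℝ) (g : (Fin m → Bool) → ℝ) :
    (∑ y, noiseOperator ρ g y ^ 2) / 2 ^ m =
      ∑ S : Finset (Fin m), ρ ^ (2 * S.card) * cubeFourierCoeff g S ^ 2 := by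
  rw [← sum_cubeFourierCoeff_sq]
  refine Finset.sum_congr rfl fun S _ => ?_
  rw [cubeFourierCoeff_noiseOperator, mul_pow, ← pow_mul, mul_comm (S.card)]

/-- **Semigroup law**: `T_ρ (T_σ g) = T_{ρσ} g` (both sides have coefficients `(ρσ)^{|S|} ĝ(S)`).
[cite: ODonnell2014, §2.4 (Exercise 2.32)] -/
theorem noiseOperator_noiseOperator (ρ σ : ℝ) (g : (Fin m → Bool) → ℝ) :
    noiseOperator ρ (noiseOperator σ g) = noiseOperator (ρ * σ) g := by
  funext y
  rw [noiseOperator_eq_sum_walsh, noiseOperator_eq_sum_walsh]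
  refine Finset.sum_congr rfl fun S _ => ?_
  rw [cubeFourierCoeff_noiseOperator, mul_pow]
  ring

/-- `T_ρ` is linear: scalars pull out. [cite: ODonnell2014, §2.4] -/
theorem noiseOperator_smul (ρ c : ℝ) (g : (Fin m → Bool) → ℝ) :
    noiseOperator ρ (fun x => c * g x) = fun y => c * noiseOperator ρ g y := by
  funext y
  unfold noiseOperator
  rw [mul_div_assoc', Finset.mul_sum]
  congr 1
  exact Finset.sum_congr rfl fun x _ => by ring

/-- `T_ρ` is additive. [cite: ODonnell2014, §2.4] -/
theorem noiseOperator_add (ρ : ℝ) (g h : (Fin m → Bool) → ℝ) :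
    noiseOperator ρ (fun x => g x + h x) = fun y => noiseOperator ρ g y + noiseOperator ρ h y := by
  funext y
  unfold noiseOperator
  rw [← add_div, ← Finset.sum_add_distrib]
  congr 1
  exact Finset.sum_congr rfl fun x _ => by ring

/-- `T_ρ 1 = 1` (and more generally `T_ρ` fixes constants). [cite: ODonnell2014, §2.4] -/
theorem noiseOperator_const (ρ c : ℝ) : noiseOperator ρ (fun _ : Fin m → Bool => c) = fun _ => c := by
  funext y
  rw [noiseOperator_eq_sum_walsh]
  have hc : ∀ S : Finset (Fin m), cubeFourierCoeff (fun _ : Fin m → Bool => c) S = if S = ∅ then c else 0 := by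
    intro S
    have h1 : cubeFourierCoeff (fun _ : Fin m → Bool => c) S =
        c * ((∑ x : Fin m → Bool, walsh ∅ x * walsh S x) / 2 ^ m) := by
      rw [cubeFourierCoeff, mul_div_assoc', Finset.mul_sum]
      congr 1
      exact Finset.sum_congr rfl fun x _ => by simp
    rw [h1, sum_walsh_mul_walsh_index]
    split_ifs with h h' h'
    · field_simp
    · exact absurd h.symm h'
    · exact absurd h'.symm h
    · simp
  simp_rw [hc]
  simp

/-! ### Means on the uniform cube: monotonicity in the exponent -/

/-- **Power-mean inequality** on a finite uniform space: for `z ≥ 0` and real `s ≥ 1`,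
`(E z)^s ≤ E[z^s]` (Jensen for `t ↦ t^s`). [cite: HardyLittlewoodPolya1952, Thm. 16 (§2.9, `M_r ≤ M_s` for `r < s`)] -/
theorem avg_rpow_le_avg_rpow_of_nonneg {ι : Type*} [Fintype ι] [Nonempty ι] (z : ι → ℝ)
    (hz : ∀ i, 0 ≤ z i) {s : ℝ} (hs : 1 ≤ s) :
    ((∑ i, z i) / Fintype.card ι) ^ s ≤ (∑ i, z i ^ s) / Fintype.card ι := by
  have hcard : (0 : ℝ) < Fintype.card ι := by exact_mod_cast Fintype.card_pos
  have h := Real.rpow_arith_mean_le_arith_mean_rpow (univ : Finset ι) (fun _ => 1 / (Fintype.card ι : ℝ))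
    z (fun _ _ => by positivity) (by simp [Finset.card_univ, hcard.ne']) (fun i _ => hz i) hs
  rw [← Finset.mul_sum, ← Finset.mul_sum] at h
  rw [div_eq_inv_mul, div_eq_inv_mul, ← one_div]
  exact h

/-- **Monotonicity of `p`-means**: for `0 < p ≤ q`, `(E|g|^p)^{1/p} ≤ (E|g|^q)^{1/q}` on any finite
uniform space. [cite: HardyLittlewoodPolya1952, Thm. 16 (§2.9, `M_r ≤ M_s` for `r < s`)] -/
theorem avg_rpow_mono {ι : Type*} [Fintype ι] [Nonempty ι] (g : ι → ℝ) {p q : ℝ} (hp : 0 < p)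
    (hpq : p ≤ q) :
    ((∑ i, |g i| ^ p) / Fintype.card ι) ^ (1 / p) ≤ ((∑ i, |g i| ^ q) / Fintype.card ι) ^ (1 / q) := by
  have hq : 0 < q := hp.trans_le hpq
  have hcard : (0 : ℝ) < Fintype.card ι := by exact_mod_cast Fintype.card_pos
  -- `(E |g|^p)^{q/p} ≤ E |g|^q`
  have h1 := avg_rpow_le_avg_rpow_of_nonneg (fun i => |g i| ^ p) (fun i => by positivity)
    (s := q / p) (by rwa [le_div_iff₀ hp, one_mul])
  have e1 : ∀ i, (|g i| ^ p) ^ (q / p) = |g i| ^ q := fun i => by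
    rw [← Real.rpow_mul (abs_nonneg _), mul_div_cancel₀ _ hp.ne']
  simp_rw [e1] at h1
  have hA : 0 ≤ (∑ i, |g i| ^ p) / Fintype.card ι := by positivity
  calc ((∑ i, |g i| ^ p) / Fintype.card ι) ^ (1 / p)
      = (((∑ i, |g i| ^ p) / Fintype.card ι) ^ (q / p)) ^ (1 / q) := by
        rw [← Real.rpow_mul hA]
        congr 1
        field_simp
    _ ≤ ((∑ i, |g i| ^ q) / Fintype.card ι) ^ (1 / q) :=
        Real.rpow_le_rpow (by positivity) h1 (by positivity)

/-- The cube has `2^m` points, as a real number. [folklore] -/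
private theorem card_cube_real (m : ℕ) : (Fintype.card (Fin m → Bool) : ℝ) = 2 ^ m := by
  simp

/-! ### `(p,2)` and `(2,q)` hypercontractivity in operator form -/

/-- **`(1+ρ², 2)`-hypercontractivity, operator form** (O'Donnell 2014, Ch. 9, "(p,2)-Hypercontractivity
Theorem: `‖T_{√(p-1)} f‖₂ ≤ ‖f‖_p`"): for `0 ≤ ρ ≤ 1`, `E[(T_ρ g)²] ≤ (E|g|^{1+ρ²})^{2/(1+ρ²)}`.
[cite: ODonnell2014, Ch. 9 ((p,2)-Hypercontractivity Theorem)] -/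
theorem avg_sq_noiseOperator_le {ρ : ℝ} (hρ0 : 0 < ρ) (hρ1 : ρ ≤ 1) (g : (Fin m → Bool) → ℝ) :
    (∑ y, noiseOperator ρ g y ^ 2) / 2 ^ m ≤ ((∑ x, |g x| ^ (1 + ρ ^ 2)) / 2 ^ m) ^ (2 / (1 + ρ ^ 2)) := by
  have hp1 : 1 < 1 + ρ ^ 2 := by nlinarith
  have hp2 : 1 + ρ ^ 2 ≤ 2 := by nlinarith
  have h := stability_le_norm_rpow hp1 hp2 g
  rw [avg_sq_noiseOperator]
  refine le_trans (le_of_eq ?_) h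
  refine Finset.sum_congr rfl fun S _ => ?_
  rw [add_sub_cancel_left, pow_mul]

/-- `T_ρ` is an `L²`-contraction for `|ρ| ≤ 1`: `E[(T_ρ g)²] ≤ E[g²]` (Parseval).
[cite: ODonnell2014, §2.4] -/
theorem avg_sq_noiseOperator_le_avg_sq {ρ : ℝ} (hρ : |ρ| ≤ 1) (g : (Fin m → Bool) → ℝ) :
    (∑ y, noiseOperator ρ g y ^ 2) / 2 ^ m ≤ (∑ x, g x ^ 2) / 2 ^ m := by
  rw [avg_sq_noiseOperator, ← sum_cubeFourierCoeff_sq]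
  refine Finset.sum_le_sum fun S _ => ?_
  have h1 : ρ ^ (2 * S.card) ≤ 1 := by
    rw [pow_mul, ← sq_abs]
    exact pow_le_one₀ (sq_nonneg _) (by nlinarith [abs_nonneg ρ])
  nlinarith [sq_nonneg (cubeFourierCoeff g S), pow_nonneg (sq_nonneg ρ) S.card, pow_mul ρ 2 S.card]

/-- Cauchy–Schwarz for uniform averages, in `rpow` form:
`E[g u] ≤ (E g²)^{1/2} (E u²)^{1/2}`. [cite: HardyLittlewoodPolya1952, Thm. 7 (§2.4, Cauchy's inequality)] -/
theorem avg_mul_le_rpow_half_mul (g u : (Fin m → Bool) → ℝ) :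
    (∑ x, g x * u x) / 2 ^ m ≤
      ((∑ x, g x ^ 2) / 2 ^ m) ^ (1 / 2 : ℝ) * ((∑ x, u x ^ 2) / 2 ^ m) ^ (1 / 2 : ℝ) := by
  have h2m : (0 : ℝ) < 2 ^ m := by positivity
  have hcs := Finset.sum_mul_sq_le_sq_mul_sq (univ : Finset (Fin m → Bool)) g u
  rw [← Real.sqrt_eq_rpow, ← Real.sqrt_eq_rpow, ← Real.sqrt_mul (by positivity), div_mul_div_comm,
    Real.sqrt_div' _ (by positivity), Real.sqrt_mul_self h2m.le]
  refine div_le_div_of_nonneg_right ?_ h2m.le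
  calc ∑ x, g x * u x ≤ |∑ x, g x * u x| := le_abs_self _
    _ = Real.sqrt ((∑ x, g x * u x) ^ 2) := (Real.sqrt_sq_eq_abs _).symm
    _ ≤ Real.sqrt ((∑ x, g x ^ 2) * ∑ x, u x ^ 2) := Real.sqrt_le_sqrt hcs

/-- `(2,q)`-hypercontractivity, the case `ρ > 0` (see `noiseOperator_hypercontractive_two_q`).
[cite: ODonnell2014, Ch. 9 (Hypercontractivity Theorem)] -/
theorem noiseOperator_hypercontractive_two_q_of_pos {q ρ : ℝ} (hq : 2 ≤ q) (hρpos : 0 < ρ)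
    (hρ : ρ ^ 2 ≤ 1 / (q - 1)) (g : (Fin m → Bool) → ℝ) :
    ((∑ y, |noiseOperator ρ g y| ^ q) / 2 ^ m) ^ (1 / q) ≤ ((∑ x, g x ^ 2) / 2 ^ m) ^ (1 / 2 : ℝ) := by
  have hq0 : 0 < q := by linarith
  have hq1 : 0 < q - 1 := by linarith
  have h2m : (0 : ℝ) < 2 ^ m := by positivity
  set u : (Fin m → Bool) → ℝ := noiseOperator ρ g with hu
  set A : ℝ := (∑ y, |u y| ^ q) / 2 ^ m with hA
  have hA0 : 0 ≤ A := by positivity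
  have hG0 : 0 ≤ ((∑ x, g x ^ 2) / 2 ^ m) ^ (1 / 2 : ℝ) := by positivity
  rcases hA0.eq_or_lt with hAz | hApos
  · rw [← hAz, Real.zero_rpow (by positivity)]
    exact hG0
  have hρ1 : ρ ≤ 1 := by
    have h1 : 1 / (q - 1) ≤ 1 := by rw [div_le_one hq1]; linarith
    nlinarith [hρ.trans h1]
  -- the dual test function `h = u |u|^{q-2}`
  set h : (Fin m → Bool) → ℝ := fun y => u y * |u y| ^ (q - 2) with hh
  have huh : ∀ y, u y * h y = |u y| ^ q := by
    intro y
    have e : u y * (u y * |u y| ^ (q - 2)) = |u y| ^ (2 : ℝ) * |u y| ^ (q - 2) := by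
      rw [← mul_assoc, Real.rpow_two, sq_abs, sq]
    rw [hh]
    simp only
    rw [e, ← Real.rpow_add' (abs_nonneg _) (by linarith)]
    congr 1; ring
  have habsh : ∀ y, |h y| = |u y| ^ (q - 1) := by
    intro y
    rw [hh]
    simp only
    rw [abs_mul, abs_of_nonneg (Real.rpow_nonneg (abs_nonneg _) _)]
    have e : |u y| * |u y| ^ (q - 2) = |u y| ^ (1 : ℝ) * |u y| ^ (q - 2) := by rw [Real.rpow_one]
    rw [e, ← Real.rpow_add' (abs_nonneg _) (by linarith)]
    congr 1; ring
  -- (1) `A = E[u h] = E[g · T_ρ h]`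
  have hstep1 : A = (∑ x, g x * noiseOperator ρ h x) / 2 ^ m := by
    rw [hA, ← sum_mul_noiseOperator_comm]
    congr 1
    exact Finset.sum_congr rfl fun y _ => by rw [← huh y, hu, mul_comm]
  -- (2) Cauchy–Schwarz
  have hstep2 := avg_mul_le_rpow_half_mul g (noiseOperator ρ h)
  -- (3) `(1+ρ²,2)`-hypercontractivity for `h`, then monotonicity of means up to `q' = q/(q-1)`
  set p : ℝ := 1 + ρ ^ 2 with hp
  have hp0 : 0 < p := by positivity
  set q' : ℝ := q / (q - 1) with hq'
  have hpq' : p ≤ q' := by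
    rw [hp, hq', le_div_iff₀ hq1]
    have : ρ ^ 2 * (q - 1) ≤ 1 := by rwa [← le_div_iff₀ hq1]
    nlinarith
  have hstep3 : ((∑ x, noiseOperator ρ h x ^ 2) / 2 ^ m) ^ (1 / 2 : ℝ) ≤
      ((∑ x, |h x| ^ q') / 2 ^ m) ^ (1 / q') := by
    have h3 := avg_sq_noiseOperator_le hρpos hρ1 h
    have h3' : ((∑ x, noiseOperator ρ h x ^ 2) / 2 ^ m) ^ (1 / 2 : ℝ) ≤
        ((∑ x, |h x| ^ p) / 2 ^ m) ^ (1 / p) := by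
      calc ((∑ x, noiseOperator ρ h x ^ 2) / 2 ^ m) ^ (1 / 2 : ℝ)
          ≤ (((∑ x, |h x| ^ (1 + ρ ^ 2)) / 2 ^ m) ^ (2 / (1 + ρ ^ 2))) ^ (1 / 2 : ℝ) :=
            Real.rpow_le_rpow (by positivity) h3 (by norm_num)
        _ = ((∑ x, |h x| ^ p) / 2 ^ m) ^ (1 / p) := by
            rw [hp, ← Real.rpow_mul (by positivity)]
            congr 1
            field_simp
    have hmono := avg_rpow_mono h hp0 hpq'
    rw [card_cube_real] at hmono
    exact h3'.trans hmono
  -- (4) `E|h|^{q'} = A`, so the right-hand side is `A^{1/q'} = A^{1 - 1/q}`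
  have hstep4 : (∑ x, |h x| ^ q') / 2 ^ m = A := by
    rw [hA]
    congr 1
    refine Finset.sum_congr rfl fun y _ => ?_
    rw [habsh, ← Real.rpow_mul (abs_nonneg _)]
    congr 1
    rw [hq']
    field_simp
  have hq'inv : 1 / q' = 1 - 1 / q := by
    rw [hq', one_div_div, sub_div, div_self hq0.ne']
  -- assemble: `A ≤ ‖g‖₂ · A^{1-1/q}`
  have hmain : A ≤ ((∑ x, g x ^ 2) / 2 ^ m) ^ (1 / 2 : ℝ) * A ^ (1 - 1 / q) := by
    calc A = (∑ x, g x * noiseOperator ρ h x) / 2 ^ m := hstep1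
      _ ≤ ((∑ x, g x ^ 2) / 2 ^ m) ^ (1 / 2 : ℝ) * ((∑ x, noiseOperator ρ h x ^ 2) / 2 ^ m) ^ (1 / 2 : ℝ) :=
          hstep2
      _ ≤ ((∑ x, g x ^ 2) / 2 ^ m) ^ (1 / 2 : ℝ) * ((∑ x, |h x| ^ q') / 2 ^ m) ^ (1 / q') :=
          mul_le_mul_of_nonneg_left hstep3 hG0
      _ = ((∑ x, g x ^ 2) / 2 ^ m) ^ (1 / 2 : ℝ) * A ^ (1 - 1 / q) := by rw [hstep4, hq'inv]
  -- divide by `A^{1-1/q} > 0`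
  have hApow : 0 < A ^ (1 - 1 / q) := Real.rpow_pos_of_pos hApos _
  have hAsplit : A = A ^ (1 / q) * A ^ (1 - 1 / q) := by
    have e1 : 1 / q + (1 - 1 / q) = 1 := by ring
    rw [← Real.rpow_add hApos, e1, Real.rpow_one]
  have h' : A ^ (1 / q) * A ^ (1 - 1 / q) ≤ ((∑ x, g x ^ 2) / 2 ^ m) ^ (1 / 2 : ℝ) * A ^ (1 - 1 / q) := by
    rw [← hAsplit]
    exact hmain
  exact le_of_mul_le_mul_right h' hApow

/-- **`(2, q)`-hypercontractivity on the uniform cube for real `q ≥ 2`** (O'Donnell 2014, Ch. 9,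
Hypercontractivity Theorem with `p = 2`: "`‖T_ρ f‖_q ≤ ‖f‖_2` for `0 ≤ ρ ≤ √(1/(q-1))`"):
`(E|T_ρ g|^q)^{1/q} ≤ (E[g²])^{1/2}`. Proof by Hölder duality from the `(1+ρ²,2)` statement
(test function `h = T_ρ g·|T_ρ g|^{q-2}`, self-adjointness, Cauchy–Schwarz, monotonicity of means,
`1 + ρ² ≤ q' = q/(q-1)`); the case `ρ = 0` via `T_0 = T_{1/(q-1)} T_0` and the `L²`-contraction.
[cite: ODonnell2014, Ch. 9 (Hypercontractivity Theorem)] -/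
theorem noiseOperator_hypercontractive_two_q {q ρ : ℝ} (hq : 2 ≤ q) (hρ0 : 0 ≤ ρ)
    (hρ : ρ ^ 2 ≤ 1 / (q - 1)) (g : (Fin m → Bool) → ℝ) :
    ((∑ y, |noiseOperator ρ g y| ^ q) / 2 ^ m) ^ (1 / q) ≤ ((∑ x, g x ^ 2) / 2 ^ m) ^ (1 / 2 : ℝ) := by
  rcases hρ0.eq_or_lt with hρz | hρpos
  · -- `ρ = 0`: `T_0 g = T_{ρ'} (T_0 g)` with `ρ' = 1/(q-1)`
    have hq1 : 0 < q - 1 := by linarith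
    set ρ' : ℝ := 1 / (q - 1) with hρ'
    have hρ'pos : 0 < ρ' := by positivity
    have hρ'sq : ρ' ^ 2 ≤ 1 / (q - 1) := by
      have h1 : ρ' ≤ 1 := by rw [hρ', div_le_one hq1]; linarith
      calc ρ' ^ 2 = ρ' * ρ' := sq ρ'
        _ ≤ ρ' * 1 := mul_le_mul_of_nonneg_left h1 hρ'pos.le
        _ = 1 / (q - 1) := by rw [mul_one]
    have hsemigroup : noiseOperator ρ g = noiseOperator ρ' (noiseOperator 0 g) := by
      rw [noiseOperator_noiseOperator, mul_zero, hρz]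
    rw [hsemigroup]
    refine (noiseOperator_hypercontractive_two_q_of_pos hq hρ'pos hρ'sq _).trans ?_
    exact Real.rpow_le_rpow (by positivity) (avg_sq_noiseOperator_le_avg_sq (by simp) g) (by norm_num)
  · exact noiseOperator_hypercontractive_two_q_of_pos hq hρpos hρ g

/-! ### Transport to a cube indexed by an arbitrary finite type -/

/-- The noise operator on a cube `{0,1}^ι` indexed by any finite type (same kernel formula).
[cite: ODonnell2014, Def. 2.46] -/
def noiseOperatorOn {ι : Type*} [Fintype ι] [DecidableEq ι] (ρ : ℝ) (g : (ι → Bool) → ℝ) (y : ι → Bool) : ℝ :=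
  (∑ x, g x * ∏ i, (1 + ρ * sgn (x i) * sgn (y i))) / 2 ^ Fintype.card ι

/-- Along a relabelling `e : ι ≃ Fin M` of the coordinates, `noiseOperatorOn` is `noiseOperator`.
[folklore] -/
private theorem noiseOperatorOn_eq_comp {ι : Type*} [Fintype ι] [DecidableEq ι] (e : ι ≃ Fin (Fintype.card ι)) (ρ : ℝ)
    (g : (ι → Bool) → ℝ) (y : ι → Bool) :
    noiseOperatorOn ρ g y =
      noiseOperator ρ (fun x' : Fin (Fintype.card ι) → Bool => g (x' ∘ e)) (y ∘ e.symm) := by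
  unfold noiseOperatorOn noiseOperator
  congr 1
  -- reindex the sum over points along `x ↦ x ∘ e.symm`
  let Φ : (ι → Bool) ≃ (Fin (Fintype.card ι) → Bool) := e.arrowCongr (Equiv.refl Bool)
  have hΦ : ∀ x : ι → Bool, Φ x = x ∘ e.symm := fun x => rfl
  rw [← Equiv.sum_comp Φ]
  refine Finset.sum_congr rfl fun x _ => ?_
  have hx : (Φ x) ∘ e = x := by
    funext i
    rw [hΦ]
    simp
  have hprod : ∏ i, (1 + ρ * sgn (x i) * sgn (y i)) =
      ∏ j, (1 + ρ * sgn (Φ x j) * sgn ((y ∘ e.symm) j)) := by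
    rw [← Equiv.prod_comp e.symm (fun i => 1 + ρ * sgn (x i) * sgn (y i))]
    rfl
  dsimp only
  rw [hx, hprod]

/-- **`(2,q)`-hypercontractivity on `{0,1}^ι`** for an arbitrary finite index type (transport of
`noiseOperator_hypercontractive_two_q` along `ι ≃ Fin |ι|`).
[cite: ODonnell2014, Ch. 9 (Hypercontractivity Theorem)] -/
theorem noiseOperatorOn_hypercontractive_two_q {ι : Type*} [Fintype ι] [DecidableEq ι] {q ρ : ℝ}
    (hq : 2 ≤ q)
    (hρ0 : 0 ≤ ρ) (hρ : ρ ^ 2 ≤ 1 / (q - 1)) (g : (ι → Bool) → ℝ) :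
    ((∑ y, |noiseOperatorOn ρ g y| ^ q) / 2 ^ Fintype.card ι) ^ (1 / q) ≤
      ((∑ x, g x ^ 2) / 2 ^ Fintype.card ι) ^ (1 / 2 : ℝ) := by
  classical
  let e : ι ≃ Fin (Fintype.card ι) := Fintype.equivFin ι
  let Φ : (ι → Bool) ≃ (Fin (Fintype.card ι) → Bool) := e.arrowCongr (Equiv.refl Bool)
  have hΦ : ∀ x : ι → Bool, Φ x = x ∘ e.symm := fun x => rfl
  set g' : (Fin (Fintype.card ι) → Bool) → ℝ := fun x' => g (x' ∘ e) with hg'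
  have hmain := noiseOperator_hypercontractive_two_q hq hρ0 hρ g'
  have hL : ∑ y, |noiseOperatorOn ρ g y| ^ q = ∑ y', |noiseOperator ρ g' y'| ^ q := by
    rw [← Equiv.sum_comp Φ]
    refine Finset.sum_congr rfl fun y _ => ?_
    rw [noiseOperatorOn_eq_comp e, hΦ]
  have hR : ∑ x, g x ^ 2 = ∑ x', g' x' ^ 2 := by
    rw [← Equiv.sum_comp Φ]
    refine Finset.sum_congr rfl fun x _ => ?_
    rw [hg', hΦ]
    simp only
    congr 2
    funext i
    simp
  rw [hL, hR]
  exact hmain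

/-! ### Symmetric moment bounds (odd functions on a cube) -/

section Odd

variable {ι : Type*} [Fintype ι] [DecidableEq ι]

/-- The global bit flip `e ↦ ¬e` is an involution of the cube. [folklore] -/
def flipAll : (ι → Bool) ≃ (ι → Bool) where
  toFun e := fun i => !e i
  invFun e := fun i => !e i
  left_inv e := by funext i; simp
  right_inv e := by funext i; simp

omit [Fintype ι] [DecidableEq ι] in
/-- [folklore] -/
@[simp] private theorem flipAll_apply (e : ι → Bool) (i : ι) : flipAll e i = !e i := rfl

/-- **Odd functions have vanishing odd moments**: if `W(¬e) = -W(e)` then `∑_e W(e)^j = 0` for odd `j`.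
[cite: KellerLifshitzMarcus2023, Lemma 3.2 (proof: "as `Z` is symmetric, all of its odd moments vanish")] -/
theorem sum_pow_eq_zero_of_odd (W : (ι → Bool) → ℝ) (hW : ∀ e, W (flipAll e) = -W e) {j : ℕ}
    (hj : Odd j) : ∑ e, W e ^ j = 0 := by
  have h : ∑ e, W e ^ j = ∑ e, W (flipAll e) ^ j := (Equiv.sum_comp flipAll (fun e => W e ^ j)).symm
  simp_rw [hW, hj.neg_pow, Finset.sum_neg_distrib] at h
  linarith

omit [DecidableEq ι] in
/-- A signed linear form `W(e) = ∑ⱼ aⱼ χⱼ(e)` is odd under the global flip (the Rademacher substitute for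
"`∑ αᵢ Zᵢ` has the same distribution as `σZ`", which is symmetric).
[cite: KellerLifshitzMarcus2023, Lemma 3.4 (proof)] -/
theorem linear_sgn_odd (a : ι → ℝ) (e : ι → Bool) :
    (∑ j, a j * sgn (flipAll e j)) = -∑ j, a j * sgn (e j) := by
  rw [← Finset.sum_neg_distrib]
  refine Finset.sum_congr rfl fun j _ => ?_
  rw [flipAll_apply]
  cases e j <;> simp [sgn]

/-- Second moment of a signed linear form: `E[(∑ⱼ aⱼ χⱼ)²] = ∑ⱼ aⱼ²` (orthonormality of the `χⱼ`).
[cite: ODonnell2014, §1.4 (Parseval)] -/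
theorem avg_sq_linear_sgn (a : ι → ℝ) :
    (∑ e : ι → Bool, (∑ j, a j * sgn (e j)) ^ 2) / 2 ^ Fintype.card ι = ∑ j, a j ^ 2 := by
  have h2 : (2 : ℝ) ^ Fintype.card ι ≠ 0 := by positivity
  -- expand the square and use `∑_e χ_j(e) χ_k(e) = 2^|ι| [j = k]`
  have horth : ∀ j k : ι, ∑ e : ι → Bool, sgn (e j) * sgn (e k) =
      if j = k then (2 : ℝ) ^ Fintype.card ι else 0 := by
    intro j k
    split_ifs with hjk
    · subst hjk
      simp only [sgn_mul_self, Finset.sum_const, Finset.card_univ, nsmul_eq_mul, mul_one]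
      simp
    · -- flip the `j`-th bit: an involution reversing the sign of the summand
      let φ : (ι → Bool) ≃ (ι → Bool) :=
        { toFun := fun e => Function.update e j (!e j)
          invFun := fun e => Function.update e j (!e j)
          left_inv := fun e => by
            funext i
            by_cases hi : i = j
            · subst hi; simp
            · simp [Function.update_of_ne hi]
          right_inv := fun e => by
            funext i
            by_cases hi : i = j
            · subst hi; simp
            · simp [Function.update_of_ne hi] }
      have hφ : ∀ e, sgn (φ e j) * sgn (φ e k) = -(sgn (e j) * sgn (e k)) := by
        intro e
        have hk : φ e k = e k := by
          show Function.update e j (!e j) k = e k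
          exact Function.update_of_ne (Ne.symm hjk) _ _
        have hj : φ e j = !e j := by
          show Function.update e j (!e j) j = !e j
          simp
        rw [hk, hj]
        cases e j <;> cases e k <;> simp [sgn]
      have hsum : ∑ e : ι → Bool, sgn (e j) * sgn (e k) = ∑ e : ι → Bool, sgn (φ e j) * sgn (φ e k) :=
        (Equiv.sum_comp φ (fun e : ι → Bool => sgn (e j) * sgn (e k))).symm
      simp_rw [hφ, Finset.sum_neg_distrib] at hsum
      linarith
  rw [div_eq_iff h2]
  calc ∑ e : ι → Bool, (∑ j, a j * sgn (e j)) ^ 2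
      = ∑ e : ι → Bool, ∑ j, ∑ k, a j * a k * (sgn (e j) * sgn (e k)) := by
        refine Finset.sum_congr rfl fun e _ => ?_
        rw [sq, Finset.sum_mul_sum]
        exact Finset.sum_congr rfl fun j _ => Finset.sum_congr rfl fun k _ => by ring
    _ = ∑ j, ∑ k, a j * a k * ∑ e : ι → Bool, sgn (e j) * sgn (e k) := by
        rw [Finset.sum_comm]
        refine Finset.sum_congr rfl fun j _ => ?_
        rw [Finset.sum_comm]
        refine Finset.sum_congr rfl fun k _ => ?_
        rw [Finset.mul_sum]
    _ = ∑ j, a j ^ 2 * 2 ^ Fintype.card ι := by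
        refine Finset.sum_congr rfl fun j _ => ?_
        simp_rw [horth, mul_ite, mul_zero]
        rw [Finset.sum_ite_eq univ j]
        simp [sq]
    _ = (∑ j, a j ^ 2) * 2 ^ Fintype.card ι := by rw [Finset.sum_mul]

/-- **Binomial lower bound for the even part**: for an odd `W` and every `n`,
`1 + C(n,2) E[W²] ≤ E[(1+W)^n]` (expand; odd moments vanish, even moments are non-negative).
[cite: KellerLifshitzMarcus2023, Lemma 3.2 (proof, "we may use the Binomial theorem to obtain …")] -/
theorem one_add_mul_avg_sq_le_avg_pow [Nonempty ι] (W : (ι → Bool) → ℝ)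
    (hW : ∀ e, W (flipAll e) = -W e) (n : ℕ) :
    1 + (n.choose 2 : ℝ) * ((∑ e, W e ^ 2) / 2 ^ Fintype.card ι) ≤
      (∑ e, (1 + W e) ^ n) / 2 ^ Fintype.card ι := by
  have h2 : (0 : ℝ) < 2 ^ Fintype.card ι := by positivity
  -- expand `(1 + W)^n = ∑_j C(n,j) W^j` and exchange the sums
  have hexp : ∀ e, (1 + W e) ^ n = ∑ j ∈ Finset.range (n + 1), (n.choose j : ℝ) * W e ^ j := by
    intro e
    rw [add_comm, add_pow]
    refine Finset.sum_congr rfl fun j _ => ?_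
    rw [one_pow, mul_one, mul_comm]
  have hswap : ∑ e : ι → Bool, (1 + W e) ^ n =
      ∑ j ∈ Finset.range (n + 1), (n.choose j : ℝ) * ∑ e : ι → Bool, W e ^ j := by
    simp_rw [hexp]
    rw [Finset.sum_comm]
    exact Finset.sum_congr rfl fun j _ => by rw [Finset.mul_sum]
  rw [hswap]
  -- each term `C(n,j) ∑_e W^j` is `≥ 0` (zero for odd `j`, a sum of even powers otherwise); keep `j = 0, 2`
  have hterm : ∀ j, 0 ≤ (n.choose j : ℝ) * ∑ e, W e ^ j := by
    intro j
    rcases Nat.even_or_odd j with hj | hj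
    · refine mul_nonneg (by positivity) (Finset.sum_nonneg fun e _ => hj.pow_nonneg _)
    · rw [sum_pow_eq_zero_of_odd W hW hj, mul_zero]
  rw [le_div_iff₀ h2]
  by_cases hn : 2 ≤ n
  · -- split off `j = 0` and `j = 2`
    have h02 : ({0, 2} : Finset ℕ) ⊆ Finset.range (n + 1) := by
      intro j hj
      simp only [Finset.mem_insert, Finset.mem_singleton] at hj
      rw [Finset.mem_range]; omega
    have hsplit := Finset.sum_le_sum_of_subset_of_nonneg h02
      (f := fun j => (n.choose j : ℝ) * ∑ e : ι → Bool, W e ^ j) (fun j _ _ => hterm j)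
    refine le_trans (le_of_eq ?_) hsplit
    rw [Finset.sum_pair (by norm_num)]
    simp only [Nat.choose_zero_right, Nat.cast_one, pow_zero, Finset.sum_const, Finset.card_univ,
      nsmul_eq_mul, mul_one, one_mul]
    rw [Fintype.card_fun, Fintype.card_bool]
    push_cast
    rw [add_mul, one_mul, mul_assoc, div_mul_cancel₀ _ h2.ne']
  · -- `n ≤ 1`: `C(n,2) = 0` and the sum is `2^|ι|` (the `j = 1` term vanishes)
    have hn' : n.choose 2 = 0 := Nat.choose_eq_zero_of_lt (by omega)
    rw [hn', Nat.cast_zero, zero_mul, add_zero, one_mul]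
    have h0 : ({0} : Finset ℕ) ⊆ Finset.range (n + 1) := by simp
    have hsplit := Finset.sum_le_sum_of_subset_of_nonneg h0
      (f := fun j => (n.choose j : ℝ) * ∑ e : ι → Bool, W e ^ j) (fun j _ _ => hterm j)
    refine le_trans (le_of_eq ?_) hsplit
    simp

/-- `C(⌊q⌋,2) ≥ q²/9` for real `q ≥ 2`. [cite: KellerLifshitzMarcus2023, Lemma 3.2 (proof, last display)] -/
theorem sq_div_nine_le_choose_floor {q : ℝ} (hq : 2 ≤ q) :
    q ^ 2 / 9 ≤ ((⌊q⌋₊).choose 2 : ℝ) := by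
  have hfl : (⌊q⌋₊ : ℝ) ≤ q := Nat.floor_le (by linarith)
  have hfl' : q < (⌊q⌋₊ : ℝ) + 1 := Nat.lt_floor_add_one q
  rw [Nat.cast_choose_two]
  by_cases h3 : 3 ≤ q
  · -- `⌊q⌋ ≥ q - 1`, so `C(⌊q⌋,2) ≥ (q-1)(q-2)/2 ≥ q²/9`
    have hk : q - 1 ≤ (⌊q⌋₊ : ℝ) := by linarith
    have h1 : (q - 1) * (q - 2) / 2 ≤ (⌊q⌋₊ : ℝ) * ((⌊q⌋₊ : ℝ) - 1) / 2 := by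
      nlinarith [mul_nonneg (sub_nonneg.2 hk) (by linarith : (0 : ℝ) ≤ (⌊q⌋₊ : ℝ) + q - 2)]
    have h2 : q ^ 2 / 9 ≤ (q - 1) * (q - 2) / 2 := by nlinarith
    linarith
  · -- `2 ≤ q < 3`: `⌊q⌋ = 2`
    push Not at h3
    have hk : ⌊q⌋₊ = 2 := by
      rw [Nat.floor_eq_iff (by linarith)]
      constructor <;> push_cast <;> linarith
    rw [hk]
    norm_num
    nlinarith

/-- **Symmetric moment lower bound** (the property of the Gaussian used in arXiv:2307.01356, Lemma 3.2,
here for any odd function on a cube, e.g. a Rademacher linear form): for real `q ≥ 2`,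
`1 + (q²/9) E[W²] ≤ E|1 + W|^q`. Chain: `E|1+W|^q = ‖1+W‖_q^q ≥ ‖1+W‖_q^{⌊q⌋} ≥ ‖1+W‖_{⌊q⌋}^{⌊q⌋}
= E|1+W|^{⌊q⌋} ≥ E(1+W)^{⌊q⌋} ≥ 1 + C(⌊q⌋,2)E[W²]`, using `‖1+W‖_q ≥ ‖1+W‖₁ ≥ E(1+W) = 1`.
[cite: KellerLifshitzMarcus2023, Lemma 3.2 (proof)] -/
theorem one_add_mul_avg_sq_le_avg_abs_rpow [Nonempty ι] (W : (ι → Bool) → ℝ)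
    (hW : ∀ e, W (flipAll e) = -W e) {q : ℝ} (hq : 2 ≤ q) :
    1 + q ^ 2 / 9 * ((∑ e, W e ^ 2) / 2 ^ Fintype.card ι) ≤
      (∑ e, |1 + W e| ^ q) / 2 ^ Fintype.card ι := by
  have h2 : (0 : ℝ) < 2 ^ Fintype.card ι := by positivity
  have hcardR : (Fintype.card (ι → Bool) : ℝ) = 2 ^ Fintype.card ι := by simp
  set n : ℕ := ⌊q⌋₊ with hn
  have hn2 : 2 ≤ n := by
    rw [hn]
    exact Nat.le_floor (by exact_mod_cast hq)
  have hnq : (n : ℝ) ≤ q := Nat.floor_le (by linarith)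
  have hn0 : (0 : ℝ) < n := by exact_mod_cast (by omega : 0 < n)
  have hq0 : 0 < q := by linarith
  -- Step A: `1 + C(n,2) E W² ≤ E (1+W)^n ≤ E |1+W|^n`
  have hA : 1 + (n.choose 2 : ℝ) * ((∑ e, W e ^ 2) / 2 ^ Fintype.card ι) ≤
      (∑ e, |1 + W e| ^ (n : ℝ)) / 2 ^ Fintype.card ι := by
    refine (one_add_mul_avg_sq_le_avg_pow W hW n).trans ?_
    refine div_le_div_of_nonneg_right (Finset.sum_le_sum fun e _ => ?_) h2.le
    rw [Real.rpow_natCast]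
    exact le_trans (le_abs_self _) (by rw [abs_pow])
  -- Step B: the `1`-mean of `|1+W|` is `≥ 1`, hence so is the `q`-mean: `M_q := (E|1+W|^q)^{1/q} ≥ 1`
  set Mq : ℝ := ((∑ e, |1 + W e| ^ q) / 2 ^ Fintype.card ι) ^ (1 / q) with hMq
  have hM1 : 1 ≤ (∑ e, |1 + W e| ^ (1 : ℝ)) / 2 ^ Fintype.card ι := by
    simp_rw [Real.rpow_one]
    rw [le_div_iff₀ h2, one_mul]
    have hsumW : ∑ e, W e = 0 := by
      have := sum_pow_eq_zero_of_odd W hW (j := 1) odd_one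
      simpa using this
    calc (2 : ℝ) ^ Fintype.card ι = ∑ e : ι → Bool, (1 + W e) := by
          rw [Finset.sum_add_distrib, hsumW, add_zero, Finset.sum_const, Finset.card_univ]
          simp
      _ ≤ ∑ e, |1 + W e| := Finset.sum_le_sum fun e _ => le_abs_self _
  have hMq1 : 1 ≤ Mq := by
    have hmono := avg_rpow_mono (fun e => 1 + W e) one_pos (by linarith : (1 : ℝ) ≤ q)
    rw [hcardR] at hmono
    rw [hMq]
    refine le_trans ?_ hmono
    rw [div_one, Real.rpow_one]
    exact hM1
  -- Step C: `E|1+W|^n ≤ M_q^n ≤ M_q^q = E|1+W|^q`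
  have hmono_nq := avg_rpow_mono (fun e => 1 + W e) hn0 hnq
  rw [hcardR] at hmono_nq
  -- `(E|1+W|^n) = ((E|1+W|^n)^{1/n})^n ≤ Mq^n`
  have hEn : (∑ e, |1 + W e| ^ (n : ℝ)) / 2 ^ Fintype.card ι ≤ Mq ^ (n : ℝ) := by
    have hpos : 0 ≤ (∑ e, |1 + W e| ^ (n : ℝ)) / 2 ^ Fintype.card ι := by positivity
    calc (∑ e, |1 + W e| ^ (n : ℝ)) / 2 ^ Fintype.card ι
        = (((∑ e, |1 + W e| ^ (n : ℝ)) / 2 ^ Fintype.card ι) ^ (1 / (n : ℝ))) ^ (n : ℝ) := by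
          rw [← Real.rpow_mul hpos, one_div_mul_cancel hn0.ne', Real.rpow_one]
      _ ≤ Mq ^ (n : ℝ) := Real.rpow_le_rpow (by positivity) hmono_nq hn0.le
  have hMnq : Mq ^ (n : ℝ) ≤ Mq ^ q := Real.rpow_le_rpow_of_exponent_le hMq1 hnq
  have hMqq : Mq ^ q = (∑ e, |1 + W e| ^ q) / 2 ^ Fintype.card ι := by
    rw [hMq, ← Real.rpow_mul (by positivity), one_div_mul_cancel hq0.ne', Real.rpow_one]
  -- Step D: constants
  have hC := sq_div_nine_le_choose_floor hq
  have hEW : 0 ≤ (∑ e, W e ^ 2) / 2 ^ Fintype.card ι := by positivity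
  calc 1 + q ^ 2 / 9 * ((∑ e, W e ^ 2) / 2 ^ Fintype.card ι)
      ≤ 1 + (n.choose 2 : ℝ) * ((∑ e, W e ^ 2) / 2 ^ Fintype.card ι) := by
        gcongr
    _ ≤ (∑ e, |1 + W e| ^ (n : ℝ)) / 2 ^ Fintype.card ι := hA
    _ ≤ Mq ^ (n : ℝ) := hEn
    _ ≤ Mq ^ q := hMnq
    _ = (∑ e, |1 + W e| ^ q) / 2 ^ Fintype.card ι := hMqq

end Odd

end Literature.Computability.Complexity.LowDegree
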